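import Summits.PneNP.PneNP.Theorems.ConvexRankGatesConvexGateBlindExactLiftingMinimalInstance

/-!
# The minimal explicit instance of the strict-rank jump, III: the PSD cone does not jump

Support file for crux `ConvexGateBlind` (stmt-PneNP-10680), line `xor-door-perfect-completeness`, open stub
`stub_exactLifting`; continuation of `…ExactLiftingMinimalInstance.lean` (instance `triLift t = M_t`,
`M_t[x,w] = 1 + 2·[w monochromatic under x]`, `rk₊(M_t) ≤ 3t²`) and `…MinimalInstanceCover.lean`
(`rk₊(M_t − J) ≥ t³/2`). Memo `STRICTRANK-MINIMAL-seat3.md` on the item.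

* `hasConeFact_triLift_shift_psd` / registered sub-goal `minimal_instance_psd_closed` — for EVERY shift `ε ≤ 1`
  the matrix `M_t − εJ` has a `(PSD_q ⊕ ℝ^1_{≥0})`-factorisation with `q = 3t² + 1`: the monochromatic indicator is
  a perfect square of Fourier degree 2, `[mono] = ((1 + σ₀σ₁ + σ₁σ₂ + σ₀σ₂)/4)²` with `σ_i = (−1)^{y_i}`
  (`one_add_signs`), and the Index-lift of a square of a combination of pair-cylinder characters is
  `tr(b(x)b(x)ᵀ · u(w)u(w)ᵀ)` with `b, u ∈ ℝ^{1 + 3t²}` (`dot_bvec_uvec`); the constant `1 − ε ≥ 0` is the single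
  non-negative rank-one term.

So on the minimal instance the PSD-strict size is `O(t²)` uniformly in `ε` (exponent 2 = the rank exponent), while the
LP endpoints are `Θ(t²)` at `ε = 0` and `Θ(t³)` at `ε = 1` (parts I–II): only the LP cone `ℝ^r_{≥0}` can jump here, and
whether it does at `ε → 0⁺` — `rk₊₊(M_t) = Θ(t²)` or `Θ(t³)` — is the open technique question (in separation form: is
there a linear-size monotone LP accepting every tripartite graph with a transversal triangle and rejecting every
bipartite one? — an SDP of that size exists by this file).
-/

set_option linter.dupNamespace false -- `Summit.PneNP.PneNP.…`: summit = sub-problem (D-0017)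

namespace Summit.PneNP.PneNP.Theorems.XorDoor.Minimal

open scoped BigOperators Classical
open Finset Matrix

noncomputable section

variable {t : ℕ}

/-- The `±1` encoding of a bit: `sgn b = (−1)^b`. -/
def sgn (b : Bool) : ℝ := if b then -1 else 1

/-- `1 + σ₀σ₁ + σ₁σ₂ + σ₀σ₂ = 4·[all three bits equal]`. -/
theorem one_add_signs (x : Row t) (w : Col t) :
    1 + (sgn (x 0 (w 0)) * sgn (x 1 (w 1)) + sgn (x 1 (w 1)) * sgn (x 2 (w 2)) +
      sgn (x 0 (w 0)) * sgn (x 2 (w 2))) = if Mono x w then 4 else 0 := by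
  unfold Mono sgn
  generalize x 0 (w 0) = a
  generalize x 1 (w 1) = b
  generalize x 2 (w 2) = c
  cases a <;> cases b <;> cases c <;> norm_num

/-- A weighted cylinder sum over one pair of coordinates collapses to the weight at the pointed pair. -/
theorem sum_pair_collapse' (f : Fin t → Fin t → ℝ) (w : Col t) (i j : Fin 3) :
    ∑ p : Fin t, ∑ q : Fin t, f p q * (if w i = p ∧ w j = q then (1 : ℝ) else 0) = f (w i) (w j) := by
  rw [Finset.sum_eq_single (w i)]
  · rw [Finset.sum_eq_single (w j)]
    · simp
    · intro q _ hq
      have hne : w j ≠ q := fun h => hq h.symm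
      simp [hne]
    · intro h; exact absurd (Finset.mem_univ _) h
  · intro p _ hp
    apply Finset.sum_eq_zero
    intro q _
    have hne : w i ≠ p := fun h => hp h.symm
    simp [hne]
  · intro h; exact absurd (Finset.mem_univ _) h

/-- Index set of the PSD factorisation: a constant slot plus (pair, pointer, pointer). -/
def idx1 (t : ℕ) : Fin (3 * (t * t) + 1) ≃ Option (Fin 3 × (Fin t × Fin t)) :=
  (finSuccEquiv (3 * (t * t))).trans (Equiv.optionCongr (idx t))

/-- Table-side vector: `1/4` on the constant slot, `σ_i(x_i p)·σ_j(x_j q)/4` on slot `(⟨i,j⟩, p, q)`. -/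
def bvecO (x : Row t) : Option (Fin 3 × (Fin t × Fin t)) → ℝ
  | none => 1 / 4
  | some k => 1 / 4 * (sgn (x (pairs k.1).1 k.2.1) * sgn (x (pairs k.1).2 k.2.2))

/-- Pointer-side vector: `1` on the constant slot, the cylinder indicator `[w_i = p ∧ w_j = q]` on slot `(⟨i,j⟩, p, q)`. -/
def uvecO (w : Col t) : Option (Fin 3 × (Fin t × Fin t)) → ℝ
  | none => 1
  | some k => if w (pairs k.1).1 = k.2.1 ∧ w (pairs k.1).2 = k.2.2 then 1 else 0

/-- The table-side vector transported to `Fin (3t² + 1)`. -/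
def bvec (t : ℕ) (x : Row t) : Fin (3 * (t * t) + 1) → ℝ := fun l => bvecO x (idx1 t l)

/-- The pointer-side vector transported to `Fin (3t² + 1)`. -/
def uvec (t : ℕ) (w : Col t) : Fin (3 * (t * t) + 1) → ℝ := fun l => uvecO w (idx1 t l)

/-- `b(x) · u(w) = [w monochromatic under x]`. -/
theorem dot_bvec_uvec (x : Row t) (w : Col t) :
    bvec t x ⬝ᵥ uvec t w = if Mono x w then 1 else 0 := by
  have hre : bvec t x ⬝ᵥ uvec t w = ∑ o : Option (Fin 3 × (Fin t × Fin t)), bvecO x o * uvecO w o := by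
    unfold dotProduct bvec uvec
    exact Fintype.sum_equiv (idx1 t) _ _ (fun l => rfl)
  rw [hre, Fintype.sum_option, Fintype.sum_prod_type, Fin.sum_univ_three]
  simp only [Fintype.sum_prod_type, bvecO, uvecO]
  have hk : ∀ k : Fin 3, ∑ p : Fin t, ∑ q : Fin t,
      1 / 4 * (sgn (x (pairs k).1 p) * sgn (x (pairs k).2 q)) *
        (if w (pairs k).1 = p ∧ w (pairs k).2 = q then (1 : ℝ) else 0) =
      1 / 4 * (sgn (x (pairs k).1 (w (pairs k).1)) * sgn (x (pairs k).2 (w (pairs k).2))) := fun k =>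
    sum_pair_collapse' (fun p q => 1 / 4 * (sgn (x (pairs k).1 p) * sgn (x (pairs k).2 q))) w (pairs k).1 (pairs k).2
  rw [hk 0, hk 1, hk 2]
  have p0 : pairs 0 = ((0 : Fin 3), (1 : Fin 3)) := rfl
  have p1 : pairs 1 = ((1 : Fin 3), (2 : Fin 3)) := rfl
  have p2 : pairs 2 = ((0 : Fin 3), (2 : Fin 3)) := rfl
  simp only [p0, p1, p2]
  have h4 := one_add_signs x w
  split_ifs at h4 ⊢ <;> linarith

/-- **The PSD cone does not jump on the minimal instance.** For every `ε ≤ 1`, `M_t − εJ` has a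
`(PSD_{3t²+1} ⊕ ℝ^1_{≥0})`-factorisation: `H_x = 2·b(x)b(x)ᵀ`, `Y_w = u(w)u(w)ᵀ` (so `tr(H_x Y_w) = 2[mono]`) and the
non-negative rank-one term `(1 − ε) ⊗ 1`. -/
theorem hasConeFact_triLift_shift_psd (t : ℕ) {ε : ℝ} (hε : ε ≤ 1) :
    HasConeFact (fun (x : Row t) (w : Col t) => triLift t x w - ε) (3 * (t * t) + 1) 1 := by
  refine ⟨fun x => vecMulVec (bvec t x) (bvec t x) + vecMulVec (bvec t x) (bvec t x),
    fun w => vecMulVec (uvec t w) (uvec t w), fun _ _ => 1 - ε, fun _ _ => 1, fun x => ?_, fun w => ?_,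
    fun _ _ => by linarith, fun _ _ => zero_le_one, fun x w => ?_⟩
  · have h : (vecMulVec (bvec t x) (bvec t x)).PosSemidef := by
      simpa using posSemidef_vecMulVec_self_star (bvec t x)
    exact h.add h
  · simpa using posSemidef_vecMulVec_self_star (uvec t w)
  · have htr : ∀ a u : Fin (3 * (t * t) + 1) → ℝ, (vecMulVec a a * vecMulVec u u).trace = (a ⬝ᵥ u) ^ 2 := by
      intro a u
      rw [mul_vecMulVec, vecMulVec_mulVec, trace_vecMulVec, op_smul_eq_smul, smul_dotProduct, smul_eq_mul, sq]
    show triLift t x w - ε = ((vecMulVec (bvec t x) (bvec t x) + vecMulVec (bvec t x) (bvec t x)) *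
        vecMulVec (uvec t w) (uvec t w)).trace + ∑ l : Fin 1, (1 - ε) * 1
    rw [Matrix.add_mul, trace_add, htr, dot_bvec_uvec, triLift_eq, Fin.sum_univ_one]
    split_ifs <;> ring

/-- **Registered sub-goal `minimal_instance_psd_closed` (stmt-PneNP-10680): the PSD side of the minimal instance is
closed at exponent 2,** uniformly in the shift: for every `t` and every `ε ≤ 1`, `triLift t − ε` factors through
`PSD_{3t²+1} ⊕ ℝ^1_{≥0}`. Together with `minimal_instance_endpoints` (LP endpoints `≤ 3t²` at `ε = 0`, `≥ t³/2` at
`ε = 1`) this certifies that only the LP cone can jump on `M_t`. -/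
theorem minimal_instance_psd_closed : ∀ (t : ℕ) (ε : ℝ), ε ≤ 1 → HasConeFact (fun (x : Fin 3 → Fin t → Bool) (w : Fin 3 → Fin t) => triLift t x w - ε) (3 * (t * t) + 1) 1 :=
  fun t _ hε => hasConeFact_triLift_shift_psd t hε

end

end Summit.PneNP.PneNP.Theorems.XorDoor.Minimal
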